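import Literature.IUT.LogVolume.TensorPacketContentBounds
import Literature.IUT.LogVolume.TensorPacketHullFieldMonotone
import HarnessLib

/-!
# [IUTchIV] Prop. 1.2 (ii) in the STAR FORM: `ι_i(g)·(R_I)^∼ ⊆ p^{⌊λ − d_{I∖{*}} − a_I⌋}·log_p(R_I^×)` for every slot `*`

Mochizuki, *Inter-universal Teichmüller theory IV*, RIMS manuscript (Apr. 2020), §1, Prop. 1.1 (p. 9) and Prop. 1.2 (ii)
(p. 10, proof p. 11). PROOF-ONLY companion (abc-iut cell, WAVE-4 prover seat abc-iut-w4-d006, gen 5; row «EXPLICIT-DEPTH-STAR»)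
of abc-iut-S1's `TensorPacketRing.lean` / abc-iut-S6's `TensorPacketLogProofs.lean` / abc-iut-w5-d082's `TensorPacketContentBounds`.

THE POINT. Prop. 1.1 is printed — and typed (`Prop11`, δ_* = 1) and proved (abc-iut-S5 `purePacket_mul_mem_integerPacket`) — in
the form `p^{d_{I*}}·(R_I)^∼ ⊆ R_I` with `I* = I ∖ {*}` for an ARBITRARY slot `*`: only `|I| − 1` differents are paid. The printed
proof of Prop. 1.2 (ii) (p. 11) then spends ALL of `d_I` («`p^{d_I+a_I}·(R_I)^∼ ⊆ ⊗ p^{a_i}·R_i`»), and so does the tree's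
`iota_smul_normalizedPacket_subset_zpow_smul_logPacket` (exponent `⌊λ − d_I − a_I⌋`, via the all-`δ` form
`purePacket_generators_mul_mem_integerPacket`). HERE the same chain is run with `δ_* = 1`:

* `purePacket_smul_normalizedPacket_subset_ppow_smul_logPacket_of_star` — for nonzero `c_i` with
  `∏‖c_i‖ ≤ p^{−(n + (d_I − d_*) + a_I)}`: `(⊗c_i)·(R_I)^∼ ⊆ p^n·log_p(R_I^×)` (no hypothesis on `|I|`);
* **`iota_smul_normalizedPacket_subset_zpow_smul_logPacket_of_star`** — for `‖g‖ = p^{−m/e_i}` and ANY slots `i, *`: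
  `ι_i(g)·(R_I)^∼ ⊆ p^{⌊m/e_i − (d_I − d_*) − a_I⌋}·log_p(R_I^×)`; the `φ`-form `image_iota_smul_normalizedPacket_subset_of_star`
  for every automorphism `φ` of `V` mapping `log_p(R_I^×)` onto itself (the literal shape of Prop. 1.2 (ii), first inclusion);
* `floor_sub_dSum_sub_aSum_le_floor_star` — the star exponent is `≥` the printed one (`d_* ≥ 0`), so the star form
  implies the printed form; it is one `p`-level better exactly when the fractional parts cross;
* TAME evaluation (`p > 2`, every `e_i ≤ p − 2`, so `d_i + a_i = 1`, `d_* = 1 − 1/e_*`):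
  `floor_star_of_tame : ⌊m/e_* − (d_I − d_*) − a_I⌋ = (m + e_* − 1) div e_* − |I| = (m − 1) div e_* + 1 − |I|`
  (vs. the printed `m div e_* − |I|`: better by one exactly when `e_* ∤ m`).

Consequence for the cell (sequel `Summits/ABC/IUTFork/Cor312LicenceExplicitDepthStar.lean`): plugged into abc-iut-w4-d026's
socket `not_licence_settingDHVolSharp_of_diag_radius`, the one-place explicit depth threshold of the (xi-f) licence refutation
gains this `p`-level, and at TAME data the refuted window becomes the exact complement of abc-iut-w5-d180's inhabited window
`e·((m_Θ−1) div e) + 1 − j(e−1) ≤ m_q` for EVERY `m_Θ` (not only `e ∣ m_Θ`). Classical local algebra throughout; the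
[IUTchIV] locators record where the cell uses it. [cite: Mochizuki2012, IUTchIV Prop. 1.1 p. 9, Prop. 1.2 (i)(ii) pp. 10–11]
[cite: SerreLocalFields1979, Ch. III §6 Prop. 13] No side taken on [IUTchIII] Cor. 3.12 [claim: Mochizuki2012, status: disputed].
PROOF-ONLY file: no definitions, no named `Prop` facts, no `sorry`.
-/

noncomputable section

open Metric Set
open scoped Pointwise TensorProduct NormedField

namespace Literature.IUT.LogVolume

variable (p : ℕ) [Fact p.Prime]
variable {I : Type} [Fintype I] [DecidableEq I]
variable (k : I → Type) [∀ i, NontriviallyNormedField (k i)] [∀ i, NormedAlgebra ℚ_[p] (k i)]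
  [∀ i, IsUltrametricDist (k i)] [∀ i, ProperSpace (k i)]

/-! ## The chain of p. 11 with `δ_* = 1` -/

/-- **The chain of [IUTchIV] p. 11 paying only `d_{I∖{*}}`.** For a slot `*`, nonzero `c_i` with
`Σ ord(c_i) ≥ n + (d_I − d_*) + a_I` (`n ∈ ℤ`): `(⊗c_i)·(R_I)^∼ ⊆ p^n·log_p(R_I^×)`. Proof as printed, with the generator of
the different at `*` replaced by `1`: `⊗c_i = (⊗ c_i δ_i⁻¹ α_i⁻¹)·(⊗δ_i)·(⊗α_i)`, `δ_* = 1`, `ord(α_i) = a_i`; the first factor is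
`p^n·y`, `y ∈ (R_I)^∼` (`exists_eq_ppow_mul_of_prod_norm_le`); `(⊗δ_i)·(R_I)^∼ ⊆ R_I` (Prop. 1.1 in its printed `I*`-form,
abc-iut-S5 `purePacket_mul_mem_integerPacket`); `(⊗α_i)·R_I ⊆ log_p(R_I^×)` (Prop. 1.2 (i)). No hypothesis on `|I|`.
[cite: Mochizuki2012, IUTchIV Prop. 1.1 p. 9, Prop. 1.2 (ii) p. 11] -/
theorem purePacket_smul_normalizedPacket_subset_ppow_smul_logPacket_of_star (star : I) {c : Π i, k i}
    (hc : ∀ i, c i ≠ 0) {n : ℤ}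
    (hn : ∏ i, ‖c i‖ ≤ (p : ℝ) ^ (-((n : ℝ) + (dSum p k - differentOrd p (k star)) + aSum p k))) :
    purePacket p k c • (normalizedPacket p k : Set (PacketAlgebra p k)) ⊆
      ppow p k n • (logPacket p k : Set (PacketAlgebra p k)) := by
  haveI : Nonempty I := ⟨star⟩
  have hp0 : (0 : ℝ) < p := by exact_mod_cast (Fact.out : p.Prime).pos
  -- generators of the differents off `*`, `1` at `*`
  choose δ₀ hδ₀ using fun i ↦ exists_different_eq_span p (k i)
  let δ : Π i, Valued.integer (k i) := Function.update δ₀ star 1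
  have hδstar : δ star = 1 := Function.update_self ..
  have hδne : ∀ i, i ≠ star → δ i = δ₀ i := fun i hi ↦ Function.update_of_ne hi ..
  have hδgen : ∀ i, i ≠ star → different p (k i) = Ideal.span {δ i} := fun i hi ↦ by rw [hδne i hi]; exact hδ₀ i
  -- norms: `‖δ_i‖ = p^{−d_i}` off `*`, `‖δ_*‖ = 1 = p^0`
  let dδ : I → ℝ := fun i ↦ if i = star then 0 else differentOrd p (k i)
  have hδn : ∀ i, ‖(δ i : k i)‖ = (p : ℝ) ^ (-dδ i) := by
    intro i
    by_cases hi : i = star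
    · subst hi
      simp only [dδ, if_pos rfl, neg_zero, Real.rpow_zero, hδstar, OneMemClass.coe_one, norm_one]
    · simp only [dδ, if_neg hi, hδne i hi]
      exact (norm_generator_different p (k i) (hδ₀ i)).2
  have hδ0 : ∀ i, (δ i : k i) ≠ 0 := fun i ↦
    norm_pos_iff.mp (by rw [hδn i]; positivity)
  have hsumδ : ∑ i, dδ i = dSum p k - differentOrd p (k star) := by
    simp only [dδ]
    rw [Finset.sum_ite, Finset.sum_const_zero, zero_add, dSum, Finset.filter_ne' Finset.univ star,
      Finset.sum_erase_eq_sub (Finset.mem_univ star)]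
  -- elements of order `a_i`
  choose α hα0 hαn using fun i ↦ exists_norm_eq_rpow_neg_logRadiusA p (k i)
  have hdα0 : ∀ i, (δ i : k i) * α i ≠ 0 := fun i ↦ mul_ne_zero (hδ0 i) (hα0 i)
  -- the quotient tensor `⊗ c_i/(δ_i α_i)` has `∏ ‖·‖ ≤ p^{−n}`
  have hG : ∏ i, ‖c i / ((δ i : k i) * α i)‖ ≤ (p : ℝ) ^ (-(n : ℝ)) := by
    have e1 : ∏ i, ‖c i / ((δ i : k i) * α i)‖ =
        (∏ i, ‖c i‖) / ((p : ℝ) ^ (-(dSum p k - differentOrd p (k star))) * (p : ℝ) ^ (-aSum p k)) := by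
      simp_rw [norm_div, norm_mul, Finset.prod_div_distrib, Finset.prod_mul_distrib]
      rw [prod_norm_eq_rpow_neg_sum p k hδn, prod_norm_eq_rpow_neg_sum p k hαn, hsumδ]
      rfl
    rw [e1, div_le_iff₀ (by positivity)]
    calc ∏ i, ‖c i‖ ≤ (p : ℝ) ^ (-((n : ℝ) + (dSum p k - differentOrd p (k star)) + aSum p k)) := hn
      _ = (p : ℝ) ^ (-(n : ℝ)) * ((p : ℝ) ^ (-(dSum p k - differentOrd p (k star))) * (p : ℝ) ^ (-aSum p k)) := by
        rw [← Real.rpow_add hp0, ← Real.rpow_add hp0]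
        congr 1
        ring
  obtain ⟨y, hy, hGy⟩ := exists_eq_ppow_mul_of_prod_norm_le p k (fun i ↦ div_ne_zero (hc i) (hdα0 i)) hG
  have hc_eq : purePacket p k c =
      ppow p k n * y * purePacket p k (fun i ↦ (δ i : k i)) * purePacket p k α := by
    rw [← hGy, purePacket_mul, purePacket_mul]
    congr 1
    funext i
    simp only [Pi.mul_apply]
    rw [mul_assoc, div_mul_cancel₀ _ (hdα0 i)]
  rintro _ ⟨x, hx, rfl⟩
  have hyx : y * x ∈ normalizedPacket p k := mul_mem hy hx
  have hr := purePacket_mul_mem_integerPacket p k star δ hδgen hδstar hyx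
  have hw := purePacket_mul_mem_logPacket p k (fun i ↦ (hαn i).le) hr
  refine ⟨_, hw, ?_⟩
  simp only [smul_eq_mul, hc_eq]
  ring

/-! ## Prop. 1.2 (ii), first inclusion, in the star form -/

/-- **[IUTchIV] Prop. 1.2 (ii), first inclusion, STAR FORM, at `φ = id`.** For ANY slots `*` and `i`, `λ = m/e_i`, `‖g‖ = p^{−λ}`:
`ι_i(g)·(R_I)^∼ ⊆ p^{⌊λ − (d_I − d_*) − a_I⌋}·log_p(R_I^×)` — the printed exponent `⌊λ − d_I − a_I⌋` improved by the
different `d_*` that Prop. 1.1 never charged. No hypothesis on `|I|`. [cite: Mochizuki2012, IUTchIV Prop. 1.1 p. 9, Prop. 1.2 (ii) p. 10] -/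
theorem iota_smul_normalizedPacket_subset_zpow_smul_logPacket_of_star (star i : I) {m : ℤ} {g : k i}
    (hg : ‖g‖ = (p : ℝ) ^ (-((m : ℝ) / absRamificationIdx p (k i)))) :
    iota p k i g • (normalizedPacket p k : Set (PacketAlgebra p k)) ⊆
      ((p : ℚ_[p]) ^ ⌊(m : ℝ) / absRamificationIdx p (k i) - (dSum p k - differentOrd p (k star)) - aSum p k⌋) •
        (logPacket p k : Set (PacketAlgebra p k)) := by
  haveI : Nonempty I := ⟨star⟩
  have hp0 : (0 : ℝ) < p := by exact_mod_cast (Fact.out : p.Prime).pos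
  have hp1 : (1 : ℝ) < p := by exact_mod_cast (Fact.out : p.Prime).one_lt
  set n : ℤ := ⌊(m : ℝ) / absRamificationIdx p (k i) - (dSum p k - differentOrd p (k star)) - aSum p k⌋ with hn_def
  have hg0 : g ≠ 0 := norm_pos_iff.mp (by rw [hg]; positivity)
  rw [← ppow_smul_set_eq, iota_eq_purePacket]
  refine purePacket_smul_normalizedPacket_subset_ppow_smul_logPacket_of_star p k star
    (fun j ↦ mulSingle_ne_zero k hg0 j) ?_
  rw [prod_norm_mulSingle k i g, hg]
  refine Real.rpow_le_rpow_of_exponent_le hp1.le ?_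
  have := Int.floor_le ((m : ℝ) / absRamificationIdx p (k i) - (dSum p k - differentOrd p (k star)) - aSum p k)
  linarith

/-- **[IUTchIV] Prop. 1.2 (ii), first inclusion, STAR FORM** for an arbitrary automorphism `φ` of `V` mapping `log_p(R_I^×)` onto
itself: `φ(ι_i(g)·(R_I)^∼) ⊆ p^{⌊λ − (d_I − d_*) − a_I⌋}·log_p(R_I^×)` («assertion (ii) follows immediately from the fact that `φ`
induces an automorphism of the submodule `log_p(R_I^×)`», p. 11). [cite: Mochizuki2012, IUTchIV Prop. 1.2 (ii) pp. 10–11] -/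
theorem image_iota_smul_normalizedPacket_subset_of_star (φ : PacketAlgebra p k ≃ₗ[ℚ_[p]] PacketAlgebra p k)
    (hφ : IsLogPacketAut p k φ) (star i : I) {m : ℤ} {g : k i}
    (hg : ‖g‖ = (p : ℝ) ^ (-((m : ℝ) / absRamificationIdx p (k i)))) :
    φ '' (iota p k i g • (normalizedPacket p k : Set (PacketAlgebra p k))) ⊆
      ppow p k ⌊(m : ℝ) / absRamificationIdx p (k i) - (dSum p k - differentOrd p (k star)) - aSum p k⌋ •
        (logPacket p k : Set (PacketAlgebra p k)) := by
  set n : ℤ := ⌊(m : ℝ) / absRamificationIdx p (k i) - (dSum p k - differentOrd p (k star)) - aSum p k⌋ with hn_def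
  have hsub := iota_smul_normalizedPacket_subset_zpow_smul_logPacket_of_star p k star i hg
  rw [← hn_def, ← ppow_smul_set_eq] at hsub
  calc (φ : PacketAlgebra p k → PacketAlgebra p k) ''
        (iota p k i g • (normalizedPacket p k : Set (PacketAlgebra p k)))
      ⊆ φ '' (ppow p k n • (logPacket p k : Set (PacketAlgebra p k))) := Set.image_mono hsub
    _ = ppow p k n • (φ '' (logPacket p k : Set (PacketAlgebra p k))) := image_ppow_smul p k φ n _
    _ = ppow p k n • (logPacket p k : Set (PacketAlgebra p k)) := by rw [hφ]

/-! ## Comparison with the printed exponent -/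

omit [DecidableEq I] in
/-- The star exponent dominates the printed one: `⌊x − d_I − a_I⌋ ≤ ⌊x − (d_I − d_*) − a_I⌋` (`d_* ≥ 0`).
[cite: Mochizuki2012, IUTchIV Prop. 1.1 p. 9] -/
theorem floor_sub_dSum_sub_aSum_le_floor_star (star : I) (x : ℝ) :
    ⌊x - dSum p k - aSum p k⌋ ≤ ⌊x - (dSum p k - differentOrd p (k star)) - aSum p k⌋ :=
  Int.floor_le_floor (by linarith [differentOrd_nonneg p (k star)])

/-- Hence the star form RECOVERS the printed first inclusion of Prop. 1.2 (ii) at `φ = id` (the tree's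
`iota_smul_normalizedPacket_subset_zpow_smul_logPacket`) — now without the hypothesis `|I| ≥ 2`.
[cite: Mochizuki2012, IUTchIV Prop. 1.2 (ii) p. 10] -/
theorem iota_smul_normalizedPacket_subset_zpow_smul_logPacket' [Nonempty I] (i : I) {m : ℤ} {g : k i}
    (hg : ‖g‖ = (p : ℝ) ^ (-((m : ℝ) / absRamificationIdx p (k i)))) :
    iota p k i g • (normalizedPacket p k : Set (PacketAlgebra p k)) ⊆
      ((p : ℚ_[p]) ^ ⌊(m : ℝ) / absRamificationIdx p (k i) - dSum p k - aSum p k⌋) •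
        (logPacket p k : Set (PacketAlgebra p k)) := by
  obtain ⟨star⟩ := (inferInstance : Nonempty I)
  exact (iota_smul_normalizedPacket_subset_zpow_smul_logPacket_of_star p k star i hg).trans
    (zpow_smul_logPacket_anti p k (floor_sub_dSum_sub_aSum_le_floor_star p k star _))

/-! ## Tame evaluation of the star exponent -/

section Tame

variable (hp : 2 < p) (he : ∀ i, absRamificationIdx p (k i) ≤ p - 2)
include hp he

omit [DecidableEq I] in
/-- At a TAME tuple (`p > 2`, every `e_i ≤ p − 2`): `x − (d_I − d_*) − a_I = x + 1 − 1/e_* − |I|` (`d_i + a_i = 1`, `a_* = 1/e_*`).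
[cite: Mochizuki2012, IUTchIV Prop. 1.2 p. 10] [cite: SerreLocalFields1979, Ch. III §6 Prop. 13] -/
theorem sub_dSum_sub_differentOrd_sub_aSum_of_tame (star : I) (x : ℝ) :
    x - (dSum p k - differentOrd p (k star)) - aSum p k =
      x + 1 - 1 / (absRamificationIdx p (k star) : ℝ) - Fintype.card I := by
  have h1 := dSum_add_aSum_eq_card_of_tame p k hp he
  have h2 := differentOrd_add_logRadiusA_eq_one_of_tame p hp (he star)
  rw [logRadiusA_eq hp (absRamificationIdx_pos p (k star)) (he star)] at h2
  linarith

omit [DecidableEq I] in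
/-- **TAME closed form of the star exponent**: for `λ = m/e_*` (the slot `*` itself, or any slot with the same index),
`⌊m/e_* − (d_I − d_*) − a_I⌋ = (m + e_* − 1) div e_* − |I|`. [cite: Mochizuki2012, IUTchIV Prop. 1.2 (ii) p. 10] -/
theorem floor_star_of_tame (star : I) (m : ℤ) :
    ⌊(m : ℝ) / absRamificationIdx p (k star) - (dSum p k - differentOrd p (k star)) - aSum p k⌋ =
      (m + absRamificationIdx p (k star) - 1) / (absRamificationIdx p (k star) : ℤ) - Fintype.card I := by
  set e : ℕ := absRamificationIdx p (k star) with he_def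
  have he0 : 0 < e := absRamificationIdx_pos p (k star)
  have heR : (e : ℝ) ≠ 0 := by exact_mod_cast he0.ne'
  rw [sub_dSum_sub_differentOrd_sub_aSum_of_tame p k hp he star, Int.floor_sub_natCast]
  congr 1
  have : (m : ℝ) / e + 1 - 1 / (e : ℝ) = ((m + e - 1 : ℤ) : ℝ) / (e : ℝ) := by
    push_cast
    field_simp
  rw [this, Int.floor_div_natCast, Int.floor_intCast]

omit [DecidableEq I] in
/-- The same closed form written with `(m − 1) div e_* + 1` (`(m + e − 1) div e = (m − 1) div e + 1`), the shape of
abc-iut-w5-d180's inhabited window `e·((m_Θ − 1) div e) + 1 − j(e−1) ≤ m_q`. [cite: Mochizuki2012, IUTchIV Prop. 1.2 (ii) p. 10] -/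
theorem floor_star_of_tame' (star : I) (m : ℤ) :
    ⌊(m : ℝ) / absRamificationIdx p (k star) - (dSum p k - differentOrd p (k star)) - aSum p k⌋ =
      (m - 1) / (absRamificationIdx p (k star) : ℤ) + 1 - Fintype.card I := by
  have he0 : (0 : ℤ) < (absRamificationIdx p (k star) : ℤ) := by exact_mod_cast absRamificationIdx_pos p (k star)
  rw [floor_star_of_tame p k hp he star m,
    show m + (absRamificationIdx p (k star) : ℤ) - 1 = (m - 1) + (absRamificationIdx p (k star) : ℤ) by ring,
    Int.add_ediv_of_dvd_right (dvd_refl _), Int.ediv_self he0.ne']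

omit [DecidableEq I] in
/-- Against the PRINTED tame exponent `⌊m/e_* − d_I − a_I⌋ = m div e_* − |I|` (abc-iut-w4-d026 `floor_sub_dSum_sub_aSum_of_tame`):
the star exponent is `(m − 1) div e_* + 1 − |I|`, i.e. larger by ONE exactly when `e_* ∤ m` and equal when `e_* ∣ m`.
[cite: Mochizuki2012, IUTchIV Prop. 1.2 (ii) p. 10] -/
theorem floor_printed_of_tame (star : I) (m : ℤ) :
    ⌊(m : ℝ) / absRamificationIdx p (k star) - dSum p k - aSum p k⌋ =
      m / (absRamificationIdx p (k star) : ℤ) - Fintype.card I := by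
  rw [sub_sub, dSum_add_aSum_eq_card_of_tame p k hp he, Int.floor_sub_natCast, Int.floor_div_natCast, Int.floor_intCast]

end Tame

end Literature.IUT.LogVolume

end
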